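import Summits.CriticalPhenomena.CardyFormulaZ2.Theorems.CardyBoundaryCoulombGasStripClusterRatesConfinedGlueTransfer
import HarnessLib

/-!
# The end-confined block event has the two-cluster rate (stub `c8_rateConfined_of_cmp`, lead c8)

Support file for line `two-cluster-rate-is-stationary-gap` (crux `StripClusterRates`, stmt-CriticalPhenomena-13878).
With `f(M,b)` the probability of the end-confined block event of `…ConfinedGlueTransfer` on `[0,M]×[0,3b+2]` and
`p₂(M,n)` the two-cluster probability (`Negative.pTwo`): if `c(b)·p₂(M,3b+2) ≤ f(M+2(b+3),b)` for all `M ≥ 1`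
(the lead's comparison) then `−log f(M,b)/M → γ` whenever `−log p₂(M,3b+2)/M → γ`.  Upper side `f ≤ p₂`
(`cg_f_le_pTwo`), lower side the comparison shifted by `K = 2(b+3)`; a squeeze. [folklore]
-/

noncomputable section

open MeasureTheory Filter Topology Set
open Literature.Probability.LatticeModels Literature.Probability.Percolation
open Summit.CriticalPhenomena.CardyFormulaZ2.Theorems.StripClusterRates.Negative (pOne pTwo rateSeqTwo rateSeqOne)

namespace Summit.CriticalPhenomena.CardyFormulaZ2.Cruxes.StripClusterRates.TwoClusterRateIsStationaryGap

/-- `K/(M+K)`-type shift: `M/(M+K) → 1` along the naturals, with the natural-number cast of `M + K`. [folklore] -/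
theorem rcf_tendsto_div_add_nat (K : ℕ) :
    Tendsto (fun M : ℕ ↦ (M : ℝ) / ((M + K : ℕ) : ℝ)) atTop (𝓝 1) := by
  refine (tendsto_natCast_div_add_atTop (K : ℝ)).congr fun M ↦ ?_
  push_cast
  rfl

/-- `(M + K : ℕ) → ∞` in `ℝ`. [folklore] -/
theorem rcf_tendsto_natCast_add_atTop (K : ℕ) :
    Tendsto (fun M : ℕ ↦ ((M + K : ℕ) : ℝ)) atTop atTop :=
  tendsto_natCast_atTop_atTop.comp (tendsto_add_atTop_nat K)

/-- **Squeeze for shifted rate sequences.** If `0 < g`, `c·p(M) ≤ g(M+K) ≤ p(M+K)` for `M ≥ 1` with `c > 0`,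
`p > 0`, and `−log p(M)/M → γ`, then `−log g(M)/M → γ`. [folklore] -/
theorem rcf_rate_of_sandwich (p g : ℕ → ℝ) (c γ : ℝ) (K : ℕ) (hc : 0 < c) (hp : ∀ M, 0 < p M)
    (hlow : ∀ M : ℕ, 1 ≤ M → c * p M ≤ g (M + K)) (hup : ∀ M : ℕ, 1 ≤ M → g (M + K) ≤ p (M + K))
    (hγ : Tendsto (fun M : ℕ ↦ -Real.log (p M) / (M : ℝ)) atTop (𝓝 γ)) :
    Tendsto (fun M : ℕ ↦ -Real.log (g M) / (M : ℝ)) atTop (𝓝 γ) := by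
  refine (tendsto_add_atTop_iff_nat K).1 ?_
  -- lower comparison sequence
  have hL : Tendsto (fun M : ℕ ↦ -Real.log (p (M + K)) / ((M + K : ℕ) : ℝ)) atTop (𝓝 γ) :=
    (tendsto_add_atTop_iff_nat (f := fun M : ℕ ↦ -Real.log (p M) / (M : ℝ)) K).2 hγ
  -- upper comparison sequence
  have hU : Tendsto (fun M : ℕ ↦ -Real.log c / ((M + K : ℕ) : ℝ) +
      -Real.log (p M) / (M : ℝ) * ((M : ℝ) / ((M + K : ℕ) : ℝ))) atTop (𝓝 (0 + γ * 1)) :=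
    (tendsto_const_nhds.div_atTop (rcf_tendsto_natCast_add_atTop K)).add (hγ.mul (rcf_tendsto_div_add_nat K))
  rw [zero_add, mul_one] at hU
  refine tendsto_of_tendsto_of_tendsto_of_le_of_le' hL hU ?_ ?_
  · filter_upwards [eventually_ge_atTop 1] with M hM
    have hgpos : 0 < g (M + K) := lt_of_lt_of_le (mul_pos hc (hp M)) (hlow M hM)
    have hlog : Real.log (g (M + K)) ≤ Real.log (p (M + K)) := Real.log_le_log hgpos (hup M hM)
    exact div_le_div_of_nonneg_right (by linarith) (by positivity)
  · filter_upwards [eventually_ge_atTop 1] with M hM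
    have hcp : 0 < c * p M := mul_pos hc (hp M)
    have hlog : Real.log (c * p M) ≤ Real.log (g (M + K)) := Real.log_le_log hcp (hlow M hM)
    rw [Real.log_mul hc.ne' (hp M).ne'] at hlog
    have hM0 : (0 : ℝ) < M := by exact_mod_cast hM
    have hMK : (0 : ℝ) < ((M + K : ℕ) : ℝ) := by positivity
    calc -Real.log (g (M + K)) / ((M + K : ℕ) : ℝ)
        ≤ (-Real.log c + -Real.log (p M)) / ((M + K : ℕ) : ℝ) :=
          div_le_div_of_nonneg_right (by linarith) hMK.le
      _ = -Real.log c / ((M + K : ℕ) : ℝ) + -Real.log (p M) / (M : ℝ) * ((M : ℝ) / ((M + K : ℕ) : ℝ)) := by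
          rw [add_div, div_mul_div_comm, mul_comm (-Real.log (p M)) (M : ℝ), mul_div_mul_left _ _ hM0.ne']

/-- **The confined event has the two-cluster rate** (stub T4a of lead c8): given the comparison
`c(b)·p₂(M,3b+2) ≤ f(M+2(b+3),b)` (`M ≥ 1`), `−log f(M,b)/M → γ` whenever `−log p₂(M,3b+2)/M → γ`, for `b ≥ 1`;
the upper comparison `f ≤ p₂` is `cg_f_le_pTwo`. [folklore] -/
theorem c8_rateConfined_of_cmp : ∀ f : ℕ → ℕ → ℝ, f = (fun M b : ℕ => (bondPercolation (zdGraph 2) half).real ((openCrossing {z ∈ (rectangle M (3 * b + 2) : Set (Site 2)) | (z 0 ≤ (b : ℤ) ∨ (M : ℤ) ≤ z 0 + b) → z 1 ≤ (b : ℤ)} (leftSide M (3 * b + 2) : Set (Site 2)) (rightSide M (3 * b + 2) : Set (Site 2)) ∩ tbCrossing b b ∩ openCrossing {z ∈ (rectangle M (3 * b + 2) : Set (Site 2)) | (z 0 ≤ (b : ℤ) ∨ (M : ℤ) ≤ z 0 + b) → 2 * (b : ℤ) + 2 ≤ z 1} (leftSide M (3 * b + 2) : Set (Site 2)) (rightSide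 M (3 * b + 2) : Set (Site 2)) ∩ (BondConfig.relabel (sym2Equiv (Site.shift (-pt 0 (2 * (b : ℤ) + 2))))) ⁻¹' tbCrossing b b) ∩ (dualConfig ⁻¹' openCrossing {z ∈ ((· + pt (-1) 0) '' (rectangle (M + 1) (3 * b + 1) : Set (Site 2))) | (z 0 ≤ (b : ℤ) ∨ (M : ℤ) ≤ z 0 + b) → (b : ℤ) + 1 ≤ z 1 ∧ z 1 ≤ 2 * (b : ℤ)} ((· + pt (-1) 0) '' (leftSide (M + 1) (3 * b + 1) : Set (Site 2))) ((· + pt (-1) 0) '' (rightSide (M + 1) (3 * b + 1) : Set (Site 2)))))) →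
    (∀ b : ℕ, 1 ≤ b → ∃ c : ℝ, 0 < c ∧ ∀ M : ℕ, 1 ≤ M → c * pTwo M (3 * b + 2) ≤ f (M + 2 * (b + 3)) b) →
    ∀ b : ℕ, 1 ≤ b → ∀ γ : ℝ, Tendsto (rateSeqTwo (3 * b + 2)) atTop (𝓝 γ) → Tendsto (fun M : ℕ ↦ -Real.log (f M b) / (M : ℝ)) atTop (𝓝 γ) := by
  intro f hf hcmp b hb γ hγ
  obtain ⟨c, hc, hcM⟩ := hcmp b hb
  have hN : 1 ≤ 3 * b + 2 := by omega
  exact rcf_rate_of_sandwich (fun M ↦ pTwo M (3 * b + 2)) (fun M ↦ f M b) c γ (2 * (b + 3)) hc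
    (fun M ↦ co_pTwo_pos hN M) hcM (fun M _ ↦ cg_f_le_pTwo f hf hb (by omega)) hγ

end Summit.CriticalPhenomena.CardyFormulaZ2.Cruxes.StripClusterRates.TwoClusterRateIsStationaryGap

end
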